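import Literature.NumberTheory.GaloisRepresentations.LocalArtinMapUnique
import Literature.NumberTheory.GaloisRepresentations.LocalArtinMapPinned
import Literature.NumberTheory.GaloisRepresentations.LocalReciprocityNormFunctoriality
import HarnessLib

/-!
# Uniqueness of Serre's reciprocity map `θ_E : Eˣ → Γ_E^ab`; independence of the base field

Topic `NumberTheory/GaloisRepresentations`; proof-only (no definition, no named fact).

J.-P. Serre, *Local Fields* XIII §4 Thm. 1–2 / J. S. Milne, *Class Field Theory* I Thm. 1.1: the local
reciprocity map is UNIQUE (characterised by the finite-level reciprocity law and the Frobenius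
normalisation).  The tree proved the uniqueness of the local ARTIN map `W_F →* Fˣ` with the five clauses
`IsLocalArtinMap` (`IsLocalArtinMap.unique_holds`, `LocalArtinMapUnique.lean`, from the Lubin–Tate norm
groups) and that the Artin map of the limit `θ` of any reciprocity system has these clauses
(`IsReciprocitySystem.isLocalArtinMap_artin_theta`, `LocalArtinMapPinned.lean`).  This file draws the
consequence for the reciprocity maps `θ` themselves:

* `IsLocalReciprocityMap.eq_of_artin_eq` — a reciprocity map `θ : Fˣ → Γ_F^ab` (`IsLocalReciprocityMap`)
  is recovered from its Artin map `w ↦ (θ⁻¹[w])⁻¹` on the Weil group (`artin_eq_iff`,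
  `artin_surjective`): two with the same Artin map are equal;
* `IsReciprocitySystem.theta_eq_theta` — **the limits `θ` of any two reciprocity systems of `F`
  coincide** (Serre's `θ_F` is unique);
* `LocalWeilDatum.theta_recSystemE_eq` — in particular, for a finite extension `E/F` of
  non-archimedean local fields, the reciprocity map of `E` READ IN THE WEIL DATUM OF `F`
  (`LocalWeilDatum.isReciprocitySystemE (F := F) (E := E)`, Neukirch IV (6.4)–(6.5): "`G_L, A_L` is
  again a class field theory") equals the one read in ANY other datum — e.g. the Weil datum of `E`
  itself (`(F := E) (E := E)`, the form used by abc-iut-L4-d3's `Cor110Nat.*`) — i.e. `θ_E` does not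
  depend on the base over which `E` is presented.  This base independence is the junction used by
  abc-iut-L4-t11's restriction/Verlagerung square for [AbsTopIII] Cor. 1.10 (i)(b) (row «COR110ib-OPEN»).

HONEST FRAMING: classical local class field theory; nothing here bears on [IUTchIII] Cor. 3.12.
-/

noncomputable section

open ValuativeRel Field

namespace Literature.NumberTheory.GaloisRepresentations

/-! ### A reciprocity map is determined by its Artin map -/

section Unique

variable {F : Type*} [Field F] [ValuativeRel F] [TopologicalSpace F] [IsNonarchimedeanLocalField F]

/-- **A reciprocity map is determined by its Artin map**: if `θ, θ' : Fˣ → Γ_F^ab` have the printed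
properties (`IsLocalReciprocityMap`) and the same Artin map `W_F →* Fˣ` (`artin w = (θ⁻¹[w])⁻¹`), then
`θ = θ'` — every `x ∈ Fˣ` is `(artin w)⁻¹` for some `w` (`artin_surjective`), and then
`θ x = [w] = θ' x` (`artin_eq_iff`). [cite: SerreLocalFields1979, Ch. XIV §6 Remark 2] -/
theorem IsLocalReciprocityMap.eq_of_artin_eq {θ θ' : Fˣ →* absoluteGaloisGroupAbelianization F}
    (hθ : IsLocalReciprocityMap F θ) (hθ' : IsLocalReciprocityMap F θ')
    (h : hθ.artin = hθ'.artin) : θ = θ' := by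
  refine MonoidHom.ext fun x => ?_
  obtain ⟨w, hw⟩ := hθ.artin_surjective x⁻¹
  have hw' : hθ'.artin w = x⁻¹ := by rw [← h, hw]
  have h1 : θ x⁻¹⁻¹ = absGaloisAbProj F (WeilGroup.toAbsGalois F w) := hθ.artin_eq_iff.mp hw
  have h2 : θ' x⁻¹⁻¹ = absGaloisAbProj F (WeilGroup.toAbsGalois F w) := hθ'.artin_eq_iff.mp hw'
  rw [inv_inv] at h1 h2
  rw [h1, h2]

/-- **Uniqueness of Serre's `θ_F`**: the limits `θ` of any two reciprocity systems `ω, ω'` of `F`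
(`IsReciprocitySystem`: the finite-level norm residue symbols with Serre's properties) are EQUAL —
both Artin maps carry the five characterising clauses (`isLocalArtinMap_artin_theta`), so they
coincide by the uniqueness of the local Artin map (`IsLocalArtinMap.unique_holds`, Milne I Thm. 1.1 /
Serre XIII §4 Thm. 1–2), hence so do the `θ`'s (`eq_of_artin_eq`).
[cite: SerreLocalFields1979, Ch. XIII §4 Thm. 1–2] -/
theorem IsReciprocitySystem.theta_eq_theta
    {ω ω' : (L : IntermediateField F (AlgebraicClosure F)) → Fˣ →* (L ≃ₐ[F] L)}
    (hω : IsReciprocitySystem F ω) (hω' : IsReciprocitySystem F ω') : hω.theta = hω'.theta :=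
  IsLocalReciprocityMap.eq_of_artin_eq
    (hω.isLocalReciprocityMap_theta (universalNormSubgroup_eq_bot F) (isClosed_of_isNormSubgroup_holds F))
    (hω'.isLocalReciprocityMap_theta (universalNormSubgroup_eq_bot F) (isClosed_of_isNormSubgroup_holds F))
    (IsLocalArtinMap.unique_holds F _ _ hω.isLocalArtinMap_artin_theta hω'.isLocalArtinMap_artin_theta)

/-- Pointwise form of `theta_eq_theta`. [cite: SerreLocalFields1979, Ch. XIII §4 Thm. 1–2] -/
theorem IsReciprocitySystem.theta_apply_eq_theta_apply
    {ω ω' : (L : IntermediateField F (AlgebraicClosure F)) → Fˣ →* (L ≃ₐ[F] L)}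
    (hω : IsReciprocitySystem F ω) (hω' : IsReciprocitySystem F ω') (x : Fˣ) :
    hω.theta x = hω'.theta x := by
  rw [hω.theta_eq_theta hω']

end Unique

/-! ### The reciprocity map of `E` does not depend on the base over which `E` is read -/

namespace LocalWeilDatum

section BaseChange

variable {F E : Type*} [Field F] [ValuativeRel F] [TopologicalSpace F] [IsNonarchimedeanLocalField F]
  [Field E] [Algebra F E] [FiniteDimensional F E] [Algebra.IsSeparable F E]
  [ValuativeRel E] [TopologicalSpace E] [IsNonarchimedeanLocalField E] [ValuativeExtension F E]

/-- **Base independence of `θ_E`**: the reciprocity map of `E` read inside the Weil datum of `F`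
(`isReciprocitySystemE (F := F) (E := E)`, Neukirch IV (6.4)–(6.5)) is the limit of ANY reciprocity
system `ω'` of `E` — Serre's `θ_E` is unique (`theta_eq_theta`).
[cite: NeukirchANT1999, Ch. IV §6, (6.4)–(6.5)] -/
theorem theta_recSystemE_eq (hcf : (localWeilDatum F).IsClassFieldTheory)
    {ω' : (L' : IntermediateField E (AlgebraicClosure E)) → Eˣ →* (L' ≃ₐ[E] L')}
    (hω' : IsReciprocitySystem E ω') :
    (isReciprocitySystemE (F := F) (E := E) hcf).theta = hω'.theta :=
  (isReciprocitySystemE (F := F) (E := E) hcf).theta_eq_theta hω'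

end BaseChange

section Self

variable {F E : Type*} [Field F] [ValuativeRel F] [TopologicalSpace F] [IsNonarchimedeanLocalField F]
  [Field E] [Algebra F E] [FiniteDimensional F E] [Algebra.IsSeparable F E]
  [ValuativeRel E] [TopologicalSpace E] [IsNonarchimedeanLocalField E] [ValuativeExtension F E]
  [ValuativeExtension E E]

/-- **`θ_E` over `F` = `θ_E` over `E`**: the canonical reciprocity map of `E` read in the Weil datum of
the base `F` (`isReciprocitySystemE (F := F) (E := E) (isClassFieldTheory_localWeilDatum F)`) equals the
one read in the Weil datum of `E` itself (`(F := E) (E := E) (isClassFieldTheory_localWeilDatum E)`, for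
`E/E` via `Algebra.id` and any `[ValuativeExtension E E]`, e.g. the tautological one used by
abc-iut-L4-d3's `Cor110Nat.*`) — the junction between the Verlagerung tower over `F` ([AbsAnab] Prop. 1.2.1 (vii),
[AbsTopIII] Cor. 1.10 (i)) and the single-field reciprocity isomorphisms `(kˣ)^∧ ⥲ G_k^ab`.
[cite: NeukirchANT1999, Ch. IV §6, (6.4)–(6.5)] -/
theorem theta_recSystemE_eq_self :
    (isReciprocitySystemE (F := F) (E := E) (isClassFieldTheory_localWeilDatum F)).theta =
      (isReciprocitySystemE (F := E) (E := E) (isClassFieldTheory_localWeilDatum E)).theta :=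
  theta_recSystemE_eq _ _

/-- Pointwise form of `theta_recSystemE_eq_self`. [cite: NeukirchANT1999, Ch. IV §6, (6.4)–(6.5)] -/
theorem theta_recSystemE_apply_eq_self (x : Eˣ) :
    (isReciprocitySystemE (F := F) (E := E) (isClassFieldTheory_localWeilDatum F)).theta x =
      (isReciprocitySystemE (F := E) (E := E) (isClassFieldTheory_localWeilDatum E)).theta x := by
  rw [theta_recSystemE_eq_self (F := F) (E := E)]

end Self

end LocalWeilDatum

end Literature.NumberTheory.GaloisRepresentations
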